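import Literature.Geometry.Symplectic.SteinJConvexOpen
import Literature.Topology.FourManifolds.SPC4HandleChainProofs
import HarnessLib

/-!
# Moving one critical value of a `J`-convex Morse function, keeping `J`-convexity

Topic `Literature/Geometry/Symplectic`; first half of brick **F1a** of the design of
`stub_upsideDownLegendrianDual` (crux `stmt-SmoothPoincare4-3546`), consumed by
`SteinSeparatingLevel.lean`.  The classical remark formalised: *the `J`-convex Morse function
of a Stein domain `(W, J, φ)` can be perturbed in the interior, keeping `J`, strict
`J`-convexity and its germ along `∂W` (hence all boundary contact data), so as to move one
critical value slightly up without changing the critical points or their indices.*  The two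
printed ingredients:

* Milnor 1965, Lemma 2.8 (PDF p. 11): *the critical values of a Morse function can be made
  distinct by adding `ε λ`, `λ` a bump `≡ 1` near one critical point and `≡ 0` near the
  others, `ε` small against `|df|` where `dλ ≠ 0`; the critical points and indices do not
  change* — in the tree for Morse functions adapted to the boundary:
  `Literature.Topology.FourManifolds.IsMorseAdapted.exists_eq_add_criticalValue`
  (`SPC4HandleChainProofs.lean`), whose proof is re-run here with one more threshold;
* Cieliebak–Eliashberg 2012, §3.2 (Eliashberg 1990, §2): *strict `J`-convexity is `C²`-open,
  uniformly on compact sets* — in the tree: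
  `Literature.Geometry.Symplectic.exists_levi_pos_perturb_of_isCompact`
  (`SteinJConvexOpen.lean`), the source of the extra threshold `|ε| < ε₁`.

Contents (everything **proved**; no definition, no named fact):

* `exists_perturb_criticalValue_levi` — Lemma 2.8, one step, with strict `J`-convexity, the
  boundary germ and a bound `f < m` inside as invariants (the Stein-structure repackaging is
  `SteinStructure.exists_perturb_criticalValue` in `SteinSeparatingLevel.lean`).

## References

* J. Milnor, *Lectures on the h-cobordism theorem*, Princeton Math. Notes (1965), §2,
  Lemma 2.8 (PDF p. 11). [MilnorHCobordism1965]
* K. Cieliebak, Ya. Eliashberg, *From Stein to Weinstein and back*, AMS Coll. Publ. 59 (2012),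
  §2.1, §3.2 (`J`-convexity is `C²`-open). [CieliebakEliashberg2012]
* R. E. Gompf, *Handlebody construction of Stein surfaces*, Ann. of Math. 148 (1998), §1.
  [Gompf1998]
-/


noncomputable section

open scoped Manifold ContDiff Topology
open Set Function Filter Metric

namespace Literature.Geometry.Symplectic

open Literature.Geometry.Kaehler Literature.Topology.FourManifolds

variable {W : Type*} [TopologicalSpace W] [T2Space W] [ChartedSpace (EuclideanHalfSpace 4) W]
  [IsManifold (𝓡∂ 4) ∞ W] [CompactSpace W]
  {J : (x : W) → (EuclideanSpace ℝ (Fin 4) →L[ℝ] EuclideanSpace ℝ (Fin 4))}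

/-! ### Milnor's Lemma 2.8 with strict `J`-convexity as an invariant -/

section Milnor

/-- **Milnor 1965, Lemma 2.8 (one step), keeping strict `J`-convexity, the boundary germ and
an upper bound inside.**  Let `f` be a Morse function on the compact `4`-manifold with boundary
`W`, without critical points on `∂W`, `< m` at interior points and strictly `J`-convex (`J`
preserving smooth vector fields); let `p` be a critical point, `F` a finite set of real numbers
and `η > 0`.  Then there is a Morse function `g` with the same critical set and the same Morse
indices, equal to `f` at the other critical points and on an open set containing `∂W`, `< m`
at interior points, strictly `J`-convex, with `g p ∉ F` and `f p < g p < f p + η`.  As printed: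
`g = f + ε λ` with `λ` a bump `≡ 1` near `p` supported in an interior chart ball away from the
other critical points, `0 < ε` smaller than Milnor's threshold (`|df| ≥ m₀ > 0` on the annulus
`{dλ ≠ 0}`), than the margin `m - f` on the ball, than `η`, and than the `J`-convexity
threshold of `exists_levi_pos_perturb_of_isCompact` (Cieliebak–Eliashberg 2012, §3.2), and
avoiding the finitely many `ε` with `f p + ε ∈ F`.
[cite: MilnorHCobordism1965, Lemma 2.8 (PDF p. 11)]
[cite: CieliebakEliashberg2012, §3.2 (J-convexity is C²-open)] -/
theorem exists_perturb_criticalValue_levi (hJ : PreservesSmoothFields J) {f : W → ℝ}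
    (hf : IsMorse (𝓡∂ 4) f)
    (hbd : ∀ x, (𝓡∂ 4).IsBoundaryPoint x → ¬ IsMCriticalPt (𝓡∂ 4) f x)
    {m : ℝ} (hlt : ∀ x, (𝓡∂ 4).IsInteriorPoint x → f x < m)
    (hconv : ∀ x (v : EuclideanSpace ℝ (Fin 4)), v ≠ 0 →
      0 < -(mextDeriv (dComplex J f) x ![v, J x v]))
    {p : W} (hp : IsMCriticalPt (𝓡∂ 4) f p) {F : Set ℝ} (hF : F.Finite) {η : ℝ} (hη : 0 < η) :
    ∃ g : W → ℝ, IsMorse (𝓡∂ 4) g ∧ criticalSet (𝓡∂ 4) g = criticalSet (𝓡∂ 4) f ∧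
      (∀ q ∈ criticalSet (𝓡∂ 4) f, morseIndex (𝓡∂ 4) g q = morseIndex (𝓡∂ 4) f q) ∧
      (∀ q ∈ criticalSet (𝓡∂ 4) f, q ≠ p → g q = f q) ∧
      (∃ U : Set W, IsOpen U ∧ (∀ x, (𝓡∂ 4).IsBoundaryPoint x → x ∈ U) ∧ EqOn g f U) ∧
      (∀ x, (𝓡∂ 4).IsInteriorPoint x → g x < m) ∧
      (∀ x (v : EuclideanSpace ℝ (Fin 4)), v ≠ 0 →
        0 < -(mextDeriv (dComplex J g) x ![v, J x v])) ∧
      g p ∉ F ∧ f p < g p ∧ g p < f p + η := by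
  classical
  have hfin : (criticalSet (𝓡∂ 4) f).Finite := IsMorse.finite_criticalSet_holds hf
  have hsmooth : ContMDiff (𝓡∂ 4) 𝓘(ℝ, ℝ) ∞ f := hf.1
  have hmdiff : ∀ y, MDifferentiableAt (𝓡∂ 4) 𝓘(ℝ, ℝ) f y := fun y =>
    hsmooth.mdifferentiableAt (by simp)
  -- `p` is an interior point
  have hpint : (𝓡∂ 4).IsInteriorPoint p :=
    ((𝓡∂ 4).isInteriorPoint_iff_not_isBoundaryPoint p).2 fun hb => hbd p hb hp
  set φ := extChartAt (𝓡∂ 4) p with hφ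
  set z₀ : EuclideanSpace ℝ (Fin 4) := φ p with hz₀
  -- the open set `V`: inside the chart domain, mapped into the interior of the model, and
  -- avoiding the other critical points
  set C' : Set W := criticalSet (𝓡∂ 4) f \ {p} with hC'
  have hC'fin : C'.Finite := hfin.subset sdiff_subset
  have hC'closed : IsClosed C' := hC'fin.isClosed
  set V : Set W := (φ.source ∩ φ ⁻¹' interior (range (𝓡∂ 4))) ∩ C'ᶜ with hV
  have hVopen : IsOpen V :=
    (isOpen_extChartAt_preimage' p isOpen_interior).inter hC'closed.isOpen_compl
  have hpV : p ∈ V := ⟨⟨mem_extChartAt_source p, hpint⟩, fun h => h.2 rfl⟩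
  -- a bump function at `p` whose closed chart ball lies in `V`
  have hs : φ.target ∩ φ.symm ⁻¹' V ∈ 𝓝[range (𝓡∂ 4)] z₀ :=
    inter_mem (extChartAt_target_mem_nhdsWithin p)
      (mem_nhdsWithin_of_mem_nhds (extChartAt_preimage_mem_nhds (hVopen.mem_nhds hpV)))
  obtain ⟨lam, -, hlam⟩ :=
    (SmoothBumpFunction.nhdsWithin_range_basis (I := 𝓡∂ 4) (c := p)).mem_iff.1 hs
  set B : Set W := φ.symm '' (closedBall z₀ lam.rOut ∩ range (𝓡∂ 4)) with hB
  have hBV : B ⊆ V := by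
    rintro _ ⟨z, hz, rfl⟩
    exact (hlam hz).2
  have hBcpt : IsCompact B := lam.isCompact_symm_image_closedBall
  have hBclosed : IsClosed B := hBcpt.isClosed
  have htsuppB : tsupport lam ⊆ B := lam.tsupport_subset_symm_image_closedBall
  have hsuppB : support lam ⊆ B := subset_closure.trans htsuppB
  have hBsrc : ∀ y ∈ B, y ∈ (chartAt (EuclideanHalfSpace 4) p).source := fun y hy => by
    have h := (hBV hy).1.1
    rwa [hφ, extChartAt_source] at h
  have hBint : ∀ y ∈ B, (𝓡∂ 4).IsInteriorPoint y := fun y hy =>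
    isInteriorPoint_of_mem_maximalAtlas
      (IsManifold.chart_mem_maximalAtlas (I := 𝓡∂ 4) (n := ∞) p) (hBsrc y hy) (hBV hy).1.2
  have hBcrit : ∀ y ∈ B, IsMCriticalPt (𝓡∂ 4) f y → y = p := fun y hy hyc => by
    by_contra hne
    exact (hBV hy).2 ⟨hyc, hne⟩
  -- off `B`, the bump vanishes near the point
  have hoffB : ∀ y, y ∉ B → (lam : W → ℝ) =ᶠ[𝓝 y] 0 := fun y hy =>
    notMem_tsupport_iff_eventuallyEq.1 fun h => hy (htsuppB h)
  -- `f < m` on the compact set `B`, with a margin `δ`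
  obtain ⟨δ, hδpos, hδ⟩ : ∃ δ > 0, ∀ y ∈ B, f y + δ ≤ m := by
    rcases B.eq_empty_or_nonempty with hBe | hBne
    · exact ⟨1, one_pos, by simp [hBe]⟩
    · obtain ⟨y₀, hy₀, hmax⟩ := hBcpt.exists_isMaxOn hBne hsmooth.continuous.continuousOn
      exact ⟨m - f y₀, sub_pos.2 (hlt y₀ (hBint y₀ hy₀)), fun y hy => by
        linarith [isMaxOn_iff.1 hmax y hy]⟩
  -- the derivative of `f` written in the chart at `p`, on the compact annulus `T`
  set Fh : EuclideanSpace ℝ (Fin 4) → ℝ := writtenInExtChartAt (𝓡∂ 4) 𝓘(ℝ, ℝ) p f with hFh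
  set Df : EuclideanSpace ℝ (Fin 4) → EuclideanSpace ℝ (Fin 4) →L[ℝ] ℝ :=
    fderivWithin ℝ Fh (range (𝓡∂ 4)) with hDf
  set T : Set (EuclideanSpace ℝ (Fin 4)) :=
    (closedBall z₀ lam.rOut \ ball z₀ lam.rIn) ∩ range (𝓡∂ 4) with hT
  have hTcpt : IsCompact T :=
    ((isCompact_closedBall z₀ lam.rOut).diff isOpen_ball).inter_right (𝓡∂ 4).isClosed_range
  have hTsub : T ⊆ closedBall z₀ lam.rOut ∩ range (𝓡∂ 4) :=
    inter_subset_inter_left _ sdiff_subset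
  have hTtgt : T ⊆ φ.target := fun z hz => (hlam (hTsub hz)).1
  have hDfcont : ContinuousOn Df T := by
    intro z hz
    have hy : φ.symm z ∈ (chartAt (EuclideanHalfSpace 4) p).source := by
      rw [← extChartAt_source (𝓡∂ 4)]; exact φ.map_target (hTtgt hz)
    have h := (contDiffWithinAt_fderivWithin_writtenInExtChartAt hsmooth (by norm_cast) hy
      ).continuousWithinAt
    rw [show extChartAt (𝓡∂ 4) p (φ.symm z) = z from φ.right_inv (hTtgt hz)] at h
    exact h.mono inter_subset_right
  have hDfne : ∀ z ∈ T, Df z ≠ 0 := by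
    intro z hz
    have hzt : z ∈ φ.target := hTtgt hz
    have hy : φ.symm z ∈ φ.source := φ.map_target hzt
    have hyB : φ.symm z ∈ B := ⟨z, hTsub hz, rfl⟩
    have hne : φ.symm z ≠ p := by
      intro h
      have hzz : z = z₀ := by rw [← φ.right_inv hzt, h]
      exact hz.1.2 (by rw [hzz]; exact mem_ball_self lam.rIn_pos)
    have hncrit : ¬ IsMCriticalPt (𝓡∂ 4) f (φ.symm z) := fun h => hne (hBcrit _ hyB h)
    rwa [isMCriticalPt_iff_fderivWithin_writtenInExtChartAt_eq_zero hy (hmdiff _),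
      φ.right_inv hzt] at hncrit
  obtain ⟨m₀, hm₀pos, hm₀⟩ : ∃ m₀ > 0, ∀ z ∈ T, m₀ ≤ ‖Df z‖ := by
    rcases T.eq_empty_or_nonempty with hTe | hTne
    · exact ⟨1, one_pos, by simp [hTe]⟩
    · obtain ⟨z₁, hz₁, hmin⟩ :=
        hTcpt.exists_isMinOn hTne (continuous_norm.comp_continuousOn hDfcont)
      exact ⟨‖Df z₁‖, norm_pos_iff.2 (hDfne z₁ hz₁), fun z hz => isMinOn_iff.1 hmin z hz⟩
  -- a global bound on the derivative of the model bump function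
  set b : EuclideanSpace ℝ (Fin 4) → ℝ := fun z => lam.toContDiffBump z with hb
  have hbdiff : Differentiable ℝ b :=
    (lam.toContDiffBump.contDiff (n := 1)).differentiable one_ne_zero
  obtain ⟨C, hC⟩ : ∃ C, ∀ z, ‖fderiv ℝ b z‖ ≤ C :=
    (lam.toContDiffBump.hasCompactSupport.fderiv (𝕜 := ℝ)).exists_bound_of_continuous
      ((lam.toContDiffBump.contDiff (n := 1)).continuous_fderiv one_ne_zero)
  have hCnn : 0 ≤ C := (norm_nonneg _).trans (hC z₀)
  -- the `J`-convexity threshold (Cieliebak–Eliashberg 2012, §3.2)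
  obtain ⟨Uc, -, hUc, ε₁, hε₁, hlevi⟩ := exists_levi_pos_perturb_of_isCompact hJ hsmooth
    lam.contMDiff isCompact_univ (fun x _ v hv => hconv x v hv)
  -- the admissible range of `ε`
  set ε₀ : ℝ := min (min δ (m₀ / (2 * (C + 1)))) (min ε₁ η) with hε₀
  have hε₀pos : 0 < ε₀ := lt_min (lt_min hδpos (by positivity)) (lt_min hε₁ hη)
  have hε₀δ : ε₀ ≤ δ := (min_le_left _ _).trans (min_le_left _ _)
  have hε₀ε₁ : ε₀ ≤ ε₁ := (min_le_right _ _).trans (min_le_left _ _)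
  have hε₀η : ε₀ ≤ η := (min_le_right _ _).trans (min_le_right _ _)
  have hε₀C : ε₀ * C < m₀ := by
    have h1 : ε₀ ≤ m₀ / (2 * (C + 1)) := (min_le_left _ _).trans (min_le_right _ _)
    have h2 : m₀ / (2 * (C + 1)) * C < m₀ := by
      rw [div_mul_eq_mul_div, div_lt_iff₀ (by positivity)]
      nlinarith
    exact lt_of_le_of_lt (mul_le_mul_of_nonneg_right h1 hCnn) h2
  -- choose `ε ∈ (0, ε₀)` avoiding the finitely many forbidden values
  have hbad : {ε : ℝ | f p + ε ∈ F}.Finite :=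
    hF.preimage fun _ _ _ _ h => add_left_cancel h
  obtain ⟨ε, ⟨hε0, hεε₀⟩, hεF⟩ := (Ioo_infinite hε₀pos).exists_notMem_finite hbad
  have hεδ : ε < δ := hεε₀.trans_le hε₀δ
  have hεη : ε < η := hεε₀.trans_le hε₀η
  have hεε₁ : |ε| < ε₁ := by rw [abs_of_pos hε0]; exact hεε₀.trans_le hε₀ε₁
  have hεC : ε * C < m₀ := lt_of_le_of_lt (mul_le_mul_of_nonneg_right hεε₀.le hCnn) hε₀C
  -- the perturbed function
  set g : W → ℝ := fun x => f x + ε * lam x with hg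
  have hgsmooth : ContMDiff (𝓡∂ 4) 𝓘(ℝ, ℝ) ∞ g := by
    have h1 : ContMDiff (𝓡∂ 4) 𝓘(ℝ, ℝ × ℝ) ∞ fun x => (f x, (lam : W → ℝ) x) :=
      hsmooth.prodMk_space lam.contMDiff
    have h2 : ContDiff ℝ ∞ fun q : ℝ × ℝ => q.1 + ε * q.2 := by fun_prop
    exact h2.comp_contMDiff h1
  have hgmdiff : ∀ y, MDifferentiableAt (𝓡∂ 4) 𝓘(ℝ, ℝ) g y := fun y =>
    hgsmooth.mdifferentiableAt (by simp)
  -- near a point off `B`, `g = f`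
  have hg_offB : ∀ y, y ∉ B → g =ᶠ[𝓝 y] fun x => f x + 0 := fun y hy => by
    filter_upwards [hoffB y hy] with x hx
    simp [hg, hx]
  -- near a point of the inner ball, `g = f + ε`
  have hg_inner : ∀ y ∈ B, dist (φ y) z₀ < lam.rIn → g =ᶠ[𝓝 y] fun x => f x + ε := by
    intro y hy hd
    filter_upwards [lam.eventuallyEq_one_of_dist_lt (hBsrc y hy) hd] with x hx
    simp [hg, hx]
  -- on the annulus, neither `f` nor `g` has critical points
  have hg_annulus : ∀ y ∈ B, lam.rIn ≤ dist (φ y) z₀ →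
      ¬ IsMCriticalPt (𝓡∂ 4) f y ∧ ¬ IsMCriticalPt (𝓡∂ 4) g y := by
    intro y hy hd
    obtain ⟨z, hz, rfl⟩ := hy
    have hzt : z ∈ φ.target := (hlam hz).1
    have hφz : φ (φ.symm z) = z := φ.right_inv hzt
    rw [hφz] at hd
    have hzT : z ∈ T := ⟨⟨hz.1, fun h => not_lt.2 hd (mem_ball.1 h)⟩, hz.2⟩
    have hysrc : φ.symm z ∈ φ.source := φ.map_target hzt
    refine ⟨fun h => hDfne z hzT ?_, fun h => ?_⟩
    · rwa [isMCriticalPt_iff_fderivWithin_writtenInExtChartAt_eq_zero hysrc (hmdiff _), hφz] at h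
    · rw [isMCriticalPt_iff_fderivWithin_writtenInExtChartAt_eq_zero hysrc (hgmdiff _), hφz] at h
      -- written in the chart, `g = Fh + ε b` on the chart target
      have htn : φ.target ∈ 𝓝[range (𝓡∂ 4)] z := by
        have h' := extChartAt_target_mem_nhdsWithin' (I := 𝓡∂ 4) hysrc
        rwa [show extChartAt (𝓡∂ 4) p (φ.symm z) = z from φ.right_inv hzt] at h'
      have hwr : writtenInExtChartAt (𝓡∂ 4) 𝓘(ℝ, ℝ) p g =ᶠ[𝓝[range (𝓡∂ 4)] z]
          fun w => Fh w + ε * b w := by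
        filter_upwards [htn] with w hw
        have hw' : w ∈ φ.target := hw
        have hws : φ.symm w ∈ (chartAt (EuclideanHalfSpace 4) p).source := by
          rw [← extChartAt_source (𝓡∂ 4)]; exact φ.map_target hw'
        have hwr' : ∀ u : W → ℝ, writtenInExtChartAt (𝓡∂ 4) 𝓘(ℝ, ℝ) p u = u ∘ φ.symm :=
          fun u => by ext w'; simp [writtenInExtChartAt, hφ]
        rw [hwr' g, hFh, hwr' f]
        simp only [Function.comp_apply, hg, hb]
        rw [lam.eqOn_source hws, Function.comp_apply]
        exact congrArg (fun u => Fh w + ε * lam.toContDiffBump u) (φ.right_inv hw')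
      have hzr : z ∈ range (𝓡∂ 4) := hz.2
      have huniq : UniqueDiffWithinAt ℝ (range (𝓡∂ 4)) z := (𝓡∂ 4).uniqueDiffOn z hzr
      have hFhd : DifferentiableWithinAt ℝ Fh (range (𝓡∂ 4)) z := by
        have hy' : φ.symm z ∈ (chartAt (EuclideanHalfSpace 4) p).source := by
          rwa [← extChartAt_source (𝓡∂ 4)]
        have := ((contMDiffAt_iff_of_mem_source (I' := 𝓘(ℝ, ℝ)) (n := ∞) (y := f p) hy'
          (by simp)).1 (hsmooth (φ.symm z))).2
        rw [hφz] at this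
        exact this.differentiableWithinAt (by simp)
      have hbd' : DifferentiableWithinAt ℝ (fun w => ε * b w) (range (𝓡∂ 4)) z :=
        ((hbdiff z).const_mul ε).differentiableWithinAt
      have key : fderivWithin ℝ (writtenInExtChartAt (𝓡∂ 4) 𝓘(ℝ, ℝ) p g) (range (𝓡∂ 4)) z =
          Df z + ε • fderiv ℝ b z := by
        rw [hwr.fderivWithin_eq_of_mem hzr, fderivWithin_fun_add huniq hFhd hbd',
          fderivWithin_const_mul huniq (hbdiff z).differentiableWithinAt,
          (hbdiff z).fderivWithin huniq]
      rw [key] at h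
      have h1 : m₀ ≤ ‖Df z‖ := hm₀ z hzT
      have h2 : ‖ε • fderiv ℝ b z‖ ≤ ε * C := by
        rw [norm_smul, Real.norm_eq_abs, abs_of_pos hε0]
        exact mul_le_mul_of_nonneg_left (hC z) hε0.le
      have h3 : ‖Df z‖ ≤ ‖Df z + ε • fderiv ℝ b z‖ + ‖ε • fderiv ℝ b z‖ := by
        simpa using norm_sub_le (Df z + ε • fderiv ℝ b z) (ε • fderiv ℝ b z)
      rw [h, norm_zero, zero_add] at h3
      linarith
  -- criticality is unchanged everywhere
  have hcrit_iff : ∀ y, IsMCriticalPt (𝓡∂ 4) g y ↔ IsMCriticalPt (𝓡∂ 4) f y := by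
    intro y
    by_cases hyB : y ∈ B
    · by_cases hd : dist (φ y) z₀ < lam.rIn
      · exact isMCriticalPt_congr_of_eventuallyEq_add_const (hg_inner y hyB hd)
      · have := hg_annulus y hyB (not_lt.1 hd)
        exact ⟨fun h => absurd h this.2, fun h => absurd h this.1⟩
    · exact isMCriticalPt_congr_of_eventuallyEq_add_const (hg_offB y hyB)
  have hcritset : criticalSet (𝓡∂ 4) g = criticalSet (𝓡∂ 4) f := by
    ext y; exact hcrit_iff y
  -- near every critical point, `g - f` is constant
  have hcrit_const : ∀ y, IsMCriticalPt (𝓡∂ 4) f y → ∃ c : ℝ, g =ᶠ[𝓝 y] fun x => f x + c := by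
    intro y hy
    by_cases hyB : y ∈ B
    · have hyp : y = p := hBcrit y hyB hy
      refine ⟨ε, ?_⟩
      rw [hyp] at hyB ⊢
      exact hg_inner p hyB (by rw [hz₀, dist_self]; exact lam.rIn_pos)
    · exact ⟨0, hg_offB y hyB⟩
  have hgp : g p = f p + ε := by simp [hg]
  refine ⟨g, ⟨hgsmooth, fun y hy => ?_⟩, hcritset, ?_, ?_, ?_, ?_, ?_, ?_, ?_, ?_⟩
  · -- nondegenerate Hessian at critical points
    have hyf : IsMCriticalPt (𝓡∂ 4) f y := (hcrit_iff y).1 hy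
    obtain ⟨c, hc⟩ := hcrit_const y hyf
    rw [mhessian_congr_of_eventuallyEq_add_const hc]
    exact hf.2 y hyf
  · -- Morse indices at critical points: `g - f` is constant near each of them
    intro q hq
    obtain ⟨c, hc⟩ := hcrit_const q hq
    unfold morseIndex
    rw [mhessian_congr_of_eventuallyEq_add_const hc]
  · -- values at the other critical points
    intro q hq hqp
    have hqB : q ∉ B := fun h => hqp (hBcrit q h hq)
    have h0 : (lam : W → ℝ) q = 0 := notMem_support.1 fun h => hqB (hsuppB h)
    simp [hg, h0]
  · -- `g = f` on the open set `Bᶜ ⊇ ∂W`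
    refine ⟨Bᶜ, hBclosed.isOpen_compl, fun x hx hxB => ?_, fun x hx => ?_⟩
    · exact ((𝓡∂ 4).isInteriorPoint_iff_not_isBoundaryPoint x).1 (hBint x hxB) hx
    · have h0 : (lam : W → ℝ) x = 0 := notMem_support.1 fun h => hx (hsuppB h)
      simp [hg, h0]
  · -- `g < m` inside
    intro y hy
    by_cases hyB : y ∈ B
    · have h1 : ε * lam y ≤ ε := by
        have := lam.le_one (x := y)
        nlinarith
      have h2 := hδ y hyB
      show f y + ε * lam y < m
      linarith
    · have h0 : (lam : W → ℝ) y = 0 := notMem_support.1 fun h => hyB (hsuppB h)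
      show f y + ε * lam y < m
      rw [h0, mul_zero, add_zero]
      exact hlt y hy
  · -- strict `J`-convexity
    intro x v hv
    have h := hlevi ε hεε₁ x (hUc (mem_univ x)) v hv
    have hfun : (f + fun y => ε * (lam : W → ℝ) y) = g := rfl
    rwa [hfun] at h
  · -- the new critical value avoids `F`
    simpa [hgp] using hεF
  · rw [hgp]; linarith
  · rw [hgp]; linarith

end Milnor

end Literature.Geometry.Symplectic

end
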